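import Mathlib
import HarnessLib
import HarnessLib.Audit
import Summits.QuantumFields.Statement
import Summits.QuantumFields.YangMills.Theorems.FemtoTransferGapSlab
import Summits.QuantumFields.YangMills.Theorems.FemtoTransferGapSlabFlowLift
import Summits.QuantumFields.YangMills.Theorems.FemtoTransferGapLevels
import Summits.QuantumFields.YangMills.Theorems.FemtoTransferGapGroundState
import Summits.QuantumFields.YangMills.Theorems.FemtoCutoffLadderDyadicNestedUpperDeficit
import Summits.QuantumFields.YangMills.Theses.ThermalTraceWindow
import HarnessLib.Audit.Status.Attr

/-!
Route: AdjointLoopFano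

# Route AdjointLoopFano — Adjoint-loop Fano window — K2a on L ≤ β^a from vacuum anti-concentration
of the zero-momentum adjoint Polyakov loop plus a kinematic Dirichlet–Fano bound (single-mode door);
poly-tail residual

D-0145 LINE g16-B of ideator seat ym-idea-4 (technique card «spectral / trace methods»). TARGET LEAF
BY NAME: `Summit.QuantumFields.YangMills.Theses.ThermalTraceWindow.SubFemtoFirstLevel` (K2a, item
stmt-QuantumFields-28291, crux rank 301, open; bears_on 28291 → K2
`ThermalTraceWindow.SubFemtoTraceRatio` 28257 → `AllWindowsColdBox.XiSuperPolySU2` 22804 = LADDER-YM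
rung R2ξ″ (RECORD label); K2a's sibling K1a/FewBodyEntropy is NOT touched). NO summit statement is
proved by this line; it decides a draft-by-design rung leaf. It suffices to show X =
(VacuumHolonomyFano ∧ AdjointLoopDirichlet) on the windows L ≤ β^a, a < 2/3, plus the declared
RESIDUAL FirstLevelPolyTail (K2a on β^a ≤ L ≤ β^A): in the exact l2-normalised vacuum Ω (tree
`exists_groundState`) take the flow-free zero-momentum ADJOINT POLYAKOV DEVIATION F = flowLift 0 d,
d(u) = 4 − (Re tr u(e₀))² ∈ [0,4]; if Var_Ω(F) ≥ M·β^(−q)·E_Ω[F] (Fano floor, B1) and the one-step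
deficit D₁(F) = λ₀‖FΩ‖² − ⟨FΩ, K_β(FΩ)⟩ ≤ C·β^(ε−1)·λ₀·E_Ω[F]/L (Dirichlet–Fano bound, B2), then the
LANDED single-mode door `Deficit.pow_secondValue_ge_deficit` (m = 1: λ₁·Var ≥ λ₀·Var − D₁) gives λ₁
≥ λ₀(1 − 1/(4L)) with M = 4C, q = 1 − ε, hence λ₁^L ≥ (3/4)λ₀^L ≥ β^(−1)λ₀^L on the window; the tail
item covers β^a ≤ L ≤ β^A.
Lean: `VacuumHolonomyFano → AdjointLoopDirichlet → FirstLevelPolyTail → Assembly →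
Summit.QuantumFields.YangMills.Theses.ThermalTraceWindow.SubFemtoFirstLevel`

## Assembly
`closes (h₁ : VacuumHolonomyFano) (h₂ : AdjointLoopDirichlet) (h₃ : FirstLevelPolyTail) (h₄ :
Assembly) : SubFemtoFirstLevel := h₄ h₁ h₂ h₃` (glue.lean; kernel-checked in Sketch.lean, rc 0,
sorries 0). The Assembly item carries the real analysis (M-sized, all doors in the tree): given A >
0, fix ε = 1/12, q = 11/12, a = 1/2 (so 2/3 < q and a + 1/3 < q); from h₂ get (C, β₀), WLOG C > 0;
from h₁ at (a, q, M := 4C) get (β₀′, L₀′); for β ≥ max(β₀, β₀′, 4/3, …) and L₀′ ≤ L ≤ β^(1/2): with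
Ω from `exists_groundState β` (IsPhys, l2 Ω Ω = 1, K_βΩ = λ₀Ω), g := F is measurable, bounded by 4,
gauge- and twist-invariant (`isPhys_flowLift 0` applied to the physical one-site function d —
conjugation-invariant and even under the centre), so `Deficit.pow_secondValue_ge_deficit … (m := 1)
le_rfl` gives λ₀·Var − D₁ ≤ λ₁·Var; h₂/h₁ give D₁ ≤ C β^(−11/12) λ₀ m₁/L ≤
(C/(L·4C))·λ₀·(4Cβ^(−11/12) m₁) ≤ λ₀ Var/(4L); Var > 0 ⇒ λ₁ ≥ λ₀(1 − 1/(4L)) > 0; Bernoulli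
(`one_add_mul_le_pow`, checked example in Sketch.lean) ⇒ λ₁^L ≥ (3/4)λ₀^L ≥ β^(−1)λ₀^L; rewrite with
`levelValue_zero`, `levelValue_one`, `topValue_su2Rep_pos`. For β^(1/2) ≤ L ≤ β^A use h₃ at (a =
1/2, A) with its k₃; output k := max(1, k₃), β₀ := max(…), L₀ := max(L₀′, L₀″) (β^(−k) is antitone
in k for β ≥ 1). The route therefore decides the rung leaf K2a, not `YangMills` (rung class,
D-0061).

Rationale: WHY THIS LINE. Mechanism (the lever): a FANO SPLIT of the single-mode bound in the exact vacuum. The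
textbook fact that the one-step effective mass of ANY observable bounds the true gap from above
([corpus:book:montvay1994-quantum-fields-lattice p.364] effective masses; Reed–Simon XIII.1
[ReedSimonIV1978]; Feynman–Bijl single-mode bounds) is in the tree as
`Deficit.pow_secondValue_ge_deficit` (multiplier trial states gΩ, any m; landed for the
FemtoCutoffLadder RG comparison with g = a pulled-back coarse ratio). Pointed at K2a with the
multiplier F = zero-momentum adjoint Polyakov deviation it reduces `λ₁^L ≥ β^(−k)λ₀^L` to
D₁(F)/Var_Ω(F) ≤ 1/(4L), and this ratio factorises through E_Ω[F]: (B2, KINEMATIC) the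
carré-du-champ identity D₁(F) = ½∬(F(U) − F(V))²Ω(U)K_β(U,V)Ω(V) together with the exact SU(2)
gradient identity |∂_ℓ tr P|² ≤ 4 − tr²P along each loop (so |∇F|² ≤ (16/L)·F: the gradient of the
adjoint deviation is small exactly where the deviation is small, and a loop of length L dilutes it
by 1/L) and the elementary convexity bound on the mean temporal plaquette in the vacuum, E[1 − ½tr
U_p] ≤ C_ε β^(ε−1) (log λ₀ is convex in β and ≥ #plaquettes·(β − C log β) by a Laplace lower bound),
give D₁ ≤ C β^(ε−1) λ₀ E_Ω[F]/L with NO large-field input; (B1, DYNAMICAL) the vacuum holonomy is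
NOT frozen: Var_Ω(F) ≥ M β^(−q) E_Ω[F] for q > 2/3 on L ≤ β^a, a < q − 1/3 — semiclassically the
zero-mode (toron-valley) coordinate has spread ḡ^(2/3) in the vacuum (Luscher1983,
KollerVanbaal1986, Vanbaal2001), so F ≈ θ² has E ≍ ḡ^(4/3) + κL/β (perimeter self-energy) and Var ≍
ḡ^(8/3) ≍ β^(−4/3), and the floor holds iff L ≪ β^(2/3). Imported from probability / spectral
theory: the Fano-factor form of the Poincaré-type single-mode inequality (variance floor relative to
the mean for a non-negative observable vanishing on the classical vacuum manifold) — the natural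
currency because both D₁ and the UV self-energy are proportional to E_Ω[F]. Why easier than K2a: B2
is kinematics + convexity (provable now, L-sized), B1 is a pure SECOND-MOMENT statement about ONE
explicit gauge-invariant observable in the state Ω² (no excited state, no entropy count, no trace,
no tracking of a slow variable under K_β, no flow), and the window exponent a < 2/3 is dictated by
the UV self-energy of an unsmeared loop, not by a tracking wall; the price is the declared residual
tail (smeared loops would need large-field control of the flow's Lipschitz constant — the Bałaban
wall, stated as its own item exactly as SlowBitWindow/SwapTwistDeficit split their entropy crux
23785/23786).

RANKED CRUXES. #2 VacuumHolonomyFano (crux) — VACUUM HOLONOMY FANO FLOOR (anti-concentration; the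
deciding crux). For all a, q, M with 0 < a, 2/3 < q, a + 1/3 < q there are β₀, L₀ such that for β ≥
β₀, L₀ ≤ L ≤ β^a and every physical l2-normalised exact ground state Ω (K_βΩ = λ₀Ω): with F =
flowLift 0 d the flow-free site average of the adjoint Polyakov deviation d(u) = 4 − (Re tr u(e₀))²
in direction 0, Var_Ω(F) := ‖FΩ‖² − ⟨FΩ,Ω⟩² ≥ M·β^(−q)·⟨FΩ,Ω⟩ and Var_Ω(F) > 0. First obligations:
(i) E_Ω[F] ≤ C(ḡ^(4/3) + L/β) (UPPER bound on the mean: perimeter self-energy linear in L, no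
worse); (ii) Var_Ω(F) ≥ c·β^(−4/3) uniformly on the window (the toron-valley spread of the vacuum, a
LOWER bound on fluctuations — by H¹-duality Var_Ω(F) ≥ Cov_Ω(F,G)²/Var_Ω(G) it suffices to exhibit
one explicit G correlated with F at the semiclassical scale). [difficulty: XL] (why it might fail:
Needs the vacuum's zero-mode spread ḡ^(2/3) and E_Ω[F] = O(ḡ^(4/3) + L/β) UNIFORMLY on L ≤ β^a incl.
large fields (Bałaban-type control of Ω², not of λ's); a log-enhanced effective potential localising
the holonomy, or a UV self-energy superlinear in L, kills the exponents (margin only β^(q−2/3)).)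
[Luscher1983, LuscherMunster1984, KollerVanbaal1986, Vanbaal2001, Balaban1989LargeFieldII,
ReedSimonIV1978]
#3 AdjointLoopDirichlet (crux) — ADJOINT-LOOP DIRICHLET–FANO BOUND (kinematic). For every ε > 0
there are C, β₀ such that for β ≥ β₀, every L ≥ 1 and every physical l2-normalised exact ground
state Ω: the one-step deficit of the multiplier F, D₁(F) = λ₀‖FΩ‖² − ⟨FΩ, K_β(FΩ)⟩, is ≤
C·β^(ε−1)·λ₀·⟨FΩ,Ω⟩/L. Route to it: carré du champ D₁ = ½∬(F(U)−F(V))²Ω(U)K_β(U,V)Ω(V); first-order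
Taylor of F across one time step in axial gauge (independent temporal plaquette increments per
spatial link, variance ≍ 1/β each) with the SU(2) identity |∂_ℓ Re tr P|² ≤ 4 − (Re tr P)² on every
link of every loop, giving Σ_ℓ|∂_ℓF|² ≤ (16/L)·F; second-order (Itô) remainder O(β^(−2)) ≤ the
budget because E_Ω[F] ≥ κL/β ≥ κ/β... is NOT used — instead the remainder is bounded by C/β² ·
(#links·sup|∂²F|)-free martingale estimates and absorbed using E_Ω[F] ≥ c₀ L/β (lower perimeter
bound, one-link conditional variance); mean temporal plaquette ≤ C_ε β^(ε−1) from convexity of log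
λ₀ in β plus a Laplace lower bound. [difficulty: L] (why it might fail: The second-order (Itô) part
of (F(U)−F(V))² per step is O(β^(−2)) (UV fluctuations of L³ loops) and must fit under
Cβ^(ε−1)E_Ω[F]/L, i.e. needs the LOWER perimeter bound E_Ω[F] ≥ c₀L/β uniformly — a one-link
conditional-variance estimate that may fail near large fields.) [ReedSimonIV1978, Luscher1983,
[corpus:book:montvay1994-quantum-fields-lattice p.364],
[corpus:book:meyn1993-markov-chains-stochastic-stability p.469-473], Balaban1985Averaging]
#4 FirstLevelPolyTail (crux) — FIRST-LEVEL POLYNOMIAL TAIL (declared RESIDUAL; the Bałaban wall of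
this line, isolated). For every a > 0 and A > 0 there are k, β₀, L₀ with β^(−k)·λ₀^L ≤ λ₁^L for β ≥
β₀ and all L with L₀ ≤ L, β^a ≤ L ≤ β^A. It is K2a restricted to polynomially large tori (so K2a ⇒
it; it does NOT give K2a: the window L ≤ β^a is missing — BC2/BC7 probes C → leaf fail). Why a
separate item: on L ≫ β^(2/3) the unsmeared loop's UV self-energy swamps the Fano floor, and smeared
(flowed) loops need a large-field Lipschitz bound for the flow — multiscale control; any K2a-window
route (SlowBitWindow, SwapTwistDeficit, QuantileBitPurity) can share this item. [difficulty: XL]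
(why it might fail: It is the XL content of K2a on polynomially large tori: control of λ₁/λ₀ to
o(1/L) uniformly up to L = β^A needs the zero-mode effective theory with o(1/L) errors over ≍ A·log
β scales incl. large fields — not in print (Bałaban controls effective densities, not level
ratios).) [Balaban1989LargeFieldII, Balaban1988Convergent, Luscher1983, Vanbaal2001,
arXiv:2305.17604]

TWO-LAYER PLAN. VacuumHolonomyFano ⇐ MeanLoopUpper (E_Ω[F] ≤ C(β^(−2/3+δ) + L/β) on the window:
perimeter self-energy upper bound for the zero-momentum adjoint loop in the vacuum) →
HolonomySpreadLower (Var_Ω(F) ≥ c β^(−4/3−δ) on the window: the vacuum does not localise the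
toron-valley coordinate below the semiclassical scale; by H¹/Cramér–Rao duality Var_Ω(F) ≥
Cov_Ω(F,G)²/Var_Ω(G) it suffices to produce ONE explicit physical G, e.g. the adjoint loop in
direction 1 or a flowed copy, with the semiclassical covariance) → VacuumHolonomyFano (arithmetic, δ
small vs the margin q − 2/3 and q − 1/3 − a) — BC3 skeleton `bc/VacuumHolonomyFano_birth.lean`.
AdjointLoopDirichlet ⇐ CarreDuChamp (D₁(g) = ½∬(g−g′)²ΩKΩ′ for physical multipliers: bilinearity +
K_βΩ = λ₀Ω, tree `Deficit.*` lemmas) → OneStepTaylor (E[(F(U)−F(V))² | U] ≤ (C/β)Σ_ℓ|∂_ℓF|²(U) +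
C′E-terms, axial-gauge product structure of K_β) → AdjointGradientIdentity (|∂_ℓ Re tr P|² ≤ 4 − (Re
tr P)², SU(2) pointwise) → MeanPlaquetteConvexity (E[1 − ½tr U_p] ≤ C_ε β^(ε−1) in Ω²⊗K_β).
FirstLevelPolyTail: not decomposed (residual).

KILL CRITERIA. VacuumHolonomyFano is refuted (route closed refuted:VacuumHolonomyFano) by a Theorems
file exhibiting windows (β_n → ∞, L_n ≤ β_n^a) and normalised ground states with Var_Ω(F) ≤ M₀
β_n^(−q) E_Ω[F] for some fixed M₀ and some admissible (a,q) — e.g. a proof that the vacuum holonomy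
distribution localises at scale o(ḡ^(2/3)) or that the UV self-energy of the unsmeared loop is
superlinear in L. AdjointLoopDirichlet is refuted by a sequence with D₁(F) ≥ c β^(−1+ε₀) λ₀ E_Ω[F]/L
· L^(δ) for fixed δ > 0 (e.g. an Itô remainder ≫ the perimeter budget). Numerically (instrument rows
below): KILL the line if small-volume vacuum Monte Carlo at β ∈ [2.5, 3.0], L ∈ {4, 6, 8} shows the
relative variance Var_Ω(F)/E_Ω[F]² of the zero-momentum adjoint Polyakov deviation DEcreasing with β
at fixed L·β^(−1/2) (predicted: ≍ const·(1 + κLβ^(1/3))^(−2), i.e. flat-to-rising once the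
self-energy is subtracted), or the one-step autocorrelation deficit D₁/(λ₀Var) exceeding 1/L.

NOT DECOMPOSED YET. FirstLevelPolyTail (residual, by design). The H¹-duality witness G for
HolonomySpreadLower is named but not typed (it needs the covariance at the semiclassical scale,
which is the physics of the crux). No item for d's physicality (routine: continuous, bounded,
conjugation- and centre-invariant one-site function; part of the Assembly).

CHEAPEST FALSIFIER. Clocked (kit minutes, or by hand): in Lüscher's zero-mode effective Hamiltonian
for SU(2) (9 constant modes c_i^a, potential (1/2g²L)Σ|[c_i,c_j]|² + the Lüscher one-loop effective
potential), compute the pure number r = Var(Σ_i θ_i²)/E(Σ_i θ_i²)² of the ground state (θ_i = L|c_i|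
the holonomy angles; by scaling r is g-independent at leading order): PASS band r ∈ [0.05, 2]; KILL
the practicality of the line (β₀ beyond any instrument) if r < 10⁻², and KILL B1 outright if the
one-loop effective potential's log-terms make the spread parametrically smaller than ḡ^(2/3) (they
do not in Luscher1983/Vanbaal2001: the valley is lifted only at order ḡ^(8/3)·L⁻¹ — to be
re-derived). In-Lean cheap check already run: BC7 8/8 CLEAN (no item is provable/refutable by the
batteries, none implies the leaf).

NUMBERS. Exponents: Var_Ω(F) ≍ β^(−4/3) (toron spread ḡ^(2/3), F ≈ θ²), E_Ω[F] ≍ β^(−2/3) + κL/β, D₁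
≲ β^(−1)·(16/L)·E_slow + O(β^(−2)) ⇒ D₁/(λ₀Var) ≍ 16β^(−1/3)/L + β^(−2/3) ≪ 1/(4L) iff L ≪ β^(2/3):
window exponent a < 2/3 (glue uses a = 1/2, q = 11/12, ε = 1/12; margins β^(1/12)). Gradient budget:
|∇F|² ≤ (16/L)·F pointwise (each of the L links of a loop contributes |∂ tr|² ≤ 4 − tr², weight L⁻³
per loop, L³ loops). Bernoulli: (1 − 1/(4L))^L ≥ 3/4. Instrument rows (INSTRUMENTS.md):
«femto-universe spectroscopy» (zero-momentum effective Hamiltonian numerics: r and the spread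
exponent 2/3) and small-volume lattice MC histograms of spatial Polyakov loops
(KollerVanbaal1986-type): Var/E² vs β at L = 4, 6, 8.

DEFINITION REQUESTS. none (F is spelled out inline from tree `flowLift`, `su2Rep`, `Matrix.trace`; a
named `adjointLoopDeviation` def would shorten the items but is not required).

Novelty: Searches (2026-08-29, corpus fts+vec AND galaxy): lit search --hybrid "effective mass upper bound
true mass gap variational transfer matrix trial state orthogonal vacuum" (6 docs:
[corpus:book:montvay1994-quantum-fields-lattice p.364-365] effective masses m(t₁,t₂,T) as upper
bounds; [corpus:book:lieb2005-mathematics-bose-gas-its-condensation p.108] trial-function upper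
bounds (Bogoliubov), Greensite 2011 pp.166–170 Polyakov lines/centre symmetry); lit search --hybrid
"Polyakov loop distribution small volume torons ground state wave function spread g^(2/3)"
(Greensite pp.119–131, [corpus:book:montvay1994-quantum-fields-lattice p.296] finite-size/torons, no
vacuum-variance statement); lit search --hybrid "carré du champ Dirichlet form Markov chain variance
bound spectral gap test function" ([corpus:book:meyn1993-markov-chains-stochastic-stability
p.469-473] drift/variance bounds — generic); lit galaxy search "single-mode
approximation|Feynman-Bijl|Bijl-Feynman" --star all (16 rows, all noise: no hits),
"torons|toron|Polyakov loop distribution" --star pdf (8 rows, noise: no hits), "femto universe|small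
volume|zero-momentum modes" --star panama (6 rows, noise: no hits). In-tree search (`rg secondValue
… l2`): the door `Deficit.pow_secondValue_ge_deficit`
(FemtoCutoffLadderDyadicNestedUpperDeficit.lean, seat ym-line-sfw-p1 for FCL crux 25766) — the same
Dirichlet principle with a DIFFERENT multiplier (pulled-back coarse top ratio) and purpose
(two-cutoff RG comparison at fixed phy  [refs: book:montvay1994-quantum-fields-lattice, book:lieb2005-mathematics-bose-gas-its-condensation, book:meyn1993-markov-chains-stochastic-stability, Luscher1983, KollerVanbaal1986, Vanbaal2001]

Barriers (technique_class: single-mode bound, carre du champ, vacuum anti-concentration): - technique_class: single-mode bound, carre du champ, vacuum anti-concentration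
- Literature.Barriers.QuantumFields.ElitzurTheorem: respected — F is a gauge-invariant (conjugation
class) function of closed spatial Polyakov holonomies, Ω is physical; no gauge fixing enters any
item (the axial gauge in B2's proof route is a change of variables inside a gauge-invariant
integral).
- Literature.Barriers.QuantumFields.tHooftAnomalyMatching: does not apply — pure SU(2) lattice gauge
theory on a finite torus, no quarks, no flavour currents, no anomaly; "vacuum" here means the exact
top eigenfunction Ω of the zero-flux spatial transfer operator at fixed (β, L), and the statement is
a fixed-lattice level bound, not a massless-QCD gap mechanism.
- Literature.Barriers.QuantumFields.GoldstoneTheorem: does not apply — no continuous global symmetry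
is broken or asserted broken (the only global symmetry in play is the centre Z₂, discrete, and the
observable is centre-blind); no order parameter, no conserved current; finite lattice.
- Literature.Barriers.QuantumFields.OehmeZimmermannSuperconvergenceNarrow: does not apply — no gluon
propagator, no covariant gauge, no superconvergence/positivity argument in the continuum; every
object is a gauge-invariant lattice expectation in the state Ω²⊗K_β.
- Literature.Barriers.QuantumFields.CenterSymmetryBreakingByQuarks (+Narrow) and the
finite-temperature deconfinement facts (Literature files FiniteTemperatureDeconfinement*,
FiniteTemperaturePolyakovDi

History (route lifecycle, newest last):
- 2026-08-29T16:12:50Z · rev 1: restated VacuumHolonomyFano (stmt-QuantumFields-23321) — rev 1 (self-audit before critic stamp): add the window cap a < 2/3 to VacuumHolonomyFano. As filed (rev 0) the binder allowed a ≥ 1 whenever q ≥ a + 1/3, and fo (planner-ym-idea-4-g16-0)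

sub-problem: YangMills · status: draft · opened planner-ym-idea-4-g16-0 2026-08-29T16:08:06Z · rev 1 · ledger route-QuantumFields-AdjointLoopFano
GENERATED by the gate from the ledger (D-0016/17). Provers cite these decls: `theorem foo : Summit.QuantumFields.YangMills.Theses.AdjointLoopFano.<Decl> := …` in Summits/QuantumFields/YangMills/Theorems/<Name>.lean.
-/

namespace Summit.QuantumFields.YangMills.Theses.AdjointLoopFano

open scoped BigOperators Topology Manifold Classical MeasureTheory ProbabilityTheory Matrix InnerProductSpace ComplexConjugate ContinuousMap
open Filter Set Function TopologicalSpace MeasureTheory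

attribute [summit_statement] _root_.YangMills

-- earlier VacuumHolonomyFano (stmt-QuantumFields-23321, replaced 2026-08-29T16:12:50Z -> stmt-QuantumFields-23326): retired by None — open Summit.QuantumFields.YangMills.Theorems.FemtoTransferGap in ∀ a q M : ℝ, 0 < a → 2 / 3 < q → a + 1 / 3 < q → ∃ β₀ : ℝ, ∃ L₀ : ℕ, ∀ β : ℝ, β₀ ≤ β → ∀ (L : ℕ) [NeZero L], L₀ ≤ L → (L : ℝ) ≤ β ^ a → ∀ Ω : Literature.MathematicalPhysics.QuantumFieldTheory.GaugeConfig
/-- item stmt-QuantumFields-23326 · crux · rank 2 · open · by planner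
why it might fail: Needs the vacuum's zero-mode spread ḡ^(2/3) and E_Ω[F] = O(ḡ^(4/3) + L/β) UNIFORMLY on L ≤ β^a incl. large fields (Bałaban-type control of Ω², not of λ's); a log-enhanced effective potential localising the holonomy, or a UV self-energy superlinear in L, kills the exponents (margin only β^(q−2/3)).
sources: Luscher1983
[crux] VACUUM HOLONOMY FANO FLOOR (anti-concentration; the deciding crux). For all a, q, M with 0 <
a, 2/3 < q, a + 1/3 < q there are β₀, L₀ such that for β ≥ β₀, L₀ ≤ L ≤ β^a and every physical
l2-normalised exact ground state Ω (K_βΩ = λ₀Ω): with F = flowLift 0 d the flow-free site average of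
the adjoint Polyakov deviation d(u) = 4 − (Re tr u(e₀))² in direction 0, Var_Ω(F) := ‖FΩ‖² − ⟨FΩ,Ω⟩²
≥ M·β^(−q)·⟨FΩ,Ω⟩ and Var_Ω(F) > 0. First obligations: (i) E_Ω[F] ≤ C(ḡ^(4/3) + L/β) (UPPER bound on
the mean: perimeter self-energy linear in L, no worse); (ii) Var_Ω(F) ≥ c·β^(−4/3) uniformly on the
window (the toron-valley spread of the vacuum, a LOWER bound on fluctuations — by H¹-duality
Var_Ω(F) ≥ Cov_Ω(F,G)²/Var_Ω(G) it suffices to exhibit one explicit G correlated with F at the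
semiclassical scale). [difficulty: XL] -/
@[route_item "route-QuantumFields-AdjointLoopFano", crux]
def VacuumHolonomyFano : Prop :=
  open Summit.QuantumFields.YangMills.Theorems.FemtoTransferGap in ∀ a q M : ℝ, 0 < a → a < 2 / 3 → 2 / 3 < q → a + 1 / 3 < q → ∃ β₀ : ℝ, ∃ L₀ : ℕ, ∀ β : ℝ, β₀ ≤ β → ∀ (L : ℕ) [NeZero L], L₀ ≤ L → (L : ℝ) ≤ β ^ a → ∀ Ω : Literature.MathematicalPhysics.QuantumFieldTheory.GaugeConfig 3 L SU2 → ℝ, IsPhys Ω → l2 Ω Ω = 1 → transferApply β Ω = topValue su2Rep L β • Ω → let F : Literature.MathematicalPhysics.QuantumFieldTheory.GaugeConfig 3 L SU2 → ℝ := flowLift 0 (fun u : Literature.MathematicalPhysics.QuantumFieldTheory.GaugeConfig 3 1 SU2 => 4 - ((su2Rep (u ((0 : Literature.MathematicalPhysics.QuantumFieldTheory.Site 3 1), (0 : Fin 3)))).trace.re) ^ 2); M * β ^ (-q) * l2 (fun U => F U * Ω U) Ω ≤ l2 (fun U => F U * Ω U) (fun U => F U * Ω U) - l2 (fun U => F U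 * Ω U) Ω ^ 2 ∧ 0 < l2 (fun U => F U * Ω U) (fun U => F U * Ω U) - l2 (fun U => F U * Ω U) Ω ^ 2

/-- item stmt-QuantumFields-23322 · crux · rank 3 · open · by planner
why it might fail: The second-order (Itô) part of (F(U)−F(V))² per step is O(β^(−2)) (UV fluctuations of L³ loops) and must fit under Cβ^(ε−1)E_Ω[F]/L, i.e. needs the LOWER perimeter bound E_Ω[F] ≥ c₀L/β uniformly — a one-link conditional-variance estimate that may fail near large fields.
sources: ReedSimonIV1978, Luscher1983, [corpus:book:montvay1994-quantum-fields-lattice p.364], [corpus:book:meyn1993-markov-chains-stochastic-stability p.469-473], Balaban1985Averaging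
[crux] ADJOINT-LOOP DIRICHLET–FANO BOUND (kinematic). For every ε > 0 there are C, β₀ such that for
β ≥ β₀, every L ≥ 1 and every physical l2-normalised exact ground state Ω: the one-step deficit of
the multiplier F, D₁(F) = λ₀‖FΩ‖² − ⟨FΩ, K_β(FΩ)⟩, is ≤ C·β^(ε−1)·λ₀·⟨FΩ,Ω⟩/L. Route to it: carré du
champ D₁ = ½∬(F(U)−F(V))²Ω(U)K_β(U,V)Ω(V); first-order Taylor of F across one time step in axial
gauge (independent temporal plaquette increments per spatial link, variance ≍ 1/β each) with the
SU(2) identity |∂_ℓ Re tr P|² ≤ 4 − (Re tr P)² on every link of every loop, giving Σ_ℓ|∂_ℓF|² ≤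
(16/L)·F; second-order (Itô) remainder O(β^(−2)) ≤ the budget because E_Ω[F] ≥ κL/β ≥ κ/β... is NOT
used — instead the remainder is bounded by C/β² · (#links·sup|∂²F|)-free martingale estimates and
absorbed using E_Ω[F] ≥ c₀ L/β (lower perimeter bound, one-link conditional variance); mean temporal
plaquette ≤ C_ε β^(ε−1) from convexity of log λ₀ in β plus a Laplace lower bound. [difficulty: L] -/
@[route_item "route-QuantumFields-AdjointLoopFano", crux]
def AdjointLoopDirichlet : Prop :=
  open Summit.QuantumFields.YangMills.Theorems.FemtoTransferGap in ∀ ε : ℝ, 0 < ε → ∃ C β₀ : ℝ, ∀ β : ℝ, β₀ ≤ β → ∀ (L : ℕ) [NeZero L], ∀ Ω : Literature.MathematicalPhysics.QuantumFieldTheory.GaugeConfig 3 L SU2 → ℝ, IsPhys Ω → l2 Ω Ω = 1 → transferApply β Ω = topValue su2Rep L β • Ω → let F : Literature.MathematicalPhysics.QuantumFieldTheory.GaugeConfig 3 L SU2 → ℝ := flowLift 0 (fun u : Literature.MathematicalPhysics.QuantumFieldTheory.GaugeConfig 3 1 SU2 => 4 - ((su2Rep (u ((0 : Literature.MathematicalPhysics.QuantumFieldTheory.Site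 3 1), (0 : Fin 3)))).trace.re) ^ 2); topValue su2Rep L β * l2 (fun U => F U * Ω U) (fun U => F U * Ω U) - l2 (fun U => F U * Ω U) (transferApply β (fun U => F U * Ω U)) ≤ C * β ^ (ε - 1) / L * topValue su2Rep L β * l2 (fun U => F U * Ω U) Ω

/-- item stmt-QuantumFields-23323 · crux · rank 4 · open · by planner
why it might fail: It is the XL content of K2a on polynomially large tori: control of λ₁/λ₀ to o(1/L) uniformly up to L = β^A needs the zero-mode effective theory with o(1/L) errors over ≍ A·log β scales incl. large fields — not in print (Bałaban controls effective densities, not level ratios).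
sources: Balaban1989LargeFieldII, Balaban1988Convergent, Luscher1983, Vanbaal2001, arXiv:2305.17604
[crux] FIRST-LEVEL POLYNOMIAL TAIL (declared RESIDUAL; the Bałaban wall of this line, isolated). For
every a > 0 and A > 0 there are k, β₀, L₀ with β^(−k)·λ₀^L ≤ λ₁^L for β ≥ β₀ and all L with L₀ ≤ L,
β^a ≤ L ≤ β^A. It is K2a restricted to polynomially large tori (so K2a ⇒ it; it does NOT give K2a:
the window L ≤ β^a is missing — BC2/BC7 probes C → leaf fail). Why a separate item: on L ≫ β^(2/3)
the unsmeared loop's UV self-energy swamps the Fano floor, and smeared (flowed) loops need a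
large-field Lipschitz bound for the flow — multiscale control; any K2a-window route (SlowBitWindow,
SwapTwistDeficit, QuantileBitPurity) can share this item. [difficulty: XL] -/
@[route_item "route-QuantumFields-AdjointLoopFano", crux]
def FirstLevelPolyTail : Prop :=
  open Summit.QuantumFields.YangMills.Theorems.FemtoTransferGap in ∀ a : ℝ, 0 < a → ∀ A : ℝ, 0 < A → ∃ k β₀ : ℝ, ∃ L₀ : ℕ, ∀ β : ℝ, β₀ ≤ β → ∀ (L : ℕ) [NeZero L], L₀ ≤ L → β ^ a ≤ (L : ℝ) → (L : ℝ) ≤ β ^ A → β ^ (-k) * levelValue su2Rep L β 0 ^ L ≤ levelValue su2Rep L β 1 ^ L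

/-- item stmt-QuantumFields-23324 · assembly · rank 1 · closed · proved by Summit.QuantumFields.YangMills.Theorems.AdjointLoopFano.assembly_proof (prover) · by planner
sources: ReedSimonIV1978, Luscher1983
[assembly] VacuumHolonomyFano → AdjointLoopDirichlet → FirstLevelPolyTail → SubFemtoFirstLevel, by
the case split L ≤ β^(1/2) / β^(1/2) ≤ L, the landed single-mode door
`Deficit.pow_secondValue_ge_deficit` (m = 1) for the multiplier F = flowLift 0 d in the exact vacuum
(`exists_groundState`, `isPhys_flowLift`), the arithmetic D₁ ≤ λ₀Var/(4L) ⇒ λ₁ ≥ λ₀(1 − 1/(4L)) ⇒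
λ₁^L ≥ (3/4)λ₀^L ≥ β^(−1)λ₀^L (Bernoulli), and `levelValue_zero/one`. [deps: VacuumHolonomyFano,
AdjointLoopDirichlet, FirstLevelPolyTail] [difficulty: M] -/
@[route_item "route-QuantumFields-AdjointLoopFano", crux]
def Assembly : Prop :=
  VacuumHolonomyFano → AdjointLoopDirichlet → FirstLevelPolyTail → Summit.QuantumFields.YangMills.Theses.ThermalTraceWindow.SubFemtoFirstLevel

-- `Assembly` holds: proved by `Summit.QuantumFields.YangMills.Theorems.AdjointLoopFano.assembly_proof` (its module imports this route file, so no `_holds` link can be stated here).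

/-! D-0027 §2.1 — DECIDING THEOREM (planner-authored via `route open/edit --closes-file`; by planner-ym-idea-4-g16-0 2026-08-29T16:12:50Z):
its hypotheses are this route's items and its conclusion the sub-problem Statement (glue_lint), and it elaborates with this file. -/

@[closes "route-QuantumFields-AdjointLoopFano"] theorem closes (h₁ : VacuumHolonomyFano) (h₂ : AdjointLoopDirichlet) (h₃ : FirstLevelPolyTail) (h₄ : Assembly) :
    Summit.QuantumFields.YangMills.Theses.ThermalTraceWindow.SubFemtoFirstLevel := h₄ h₁ h₂ h₃

end Summit.QuantumFields.YangMills.Theses.AdjointLoopFano
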